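import Summits.NavierStokesRegularity.NavierStokesRegularity.Theses.ClockStretchingLaw
import Summits.NavierStokesRegularity.NavierStokesRegularity.Theorems.ClockStretchingLawSteadySliceLiouvilleStability
import Summits.NavierStokesRegularity.NavierStokesRegularity.Theorems.ClockStretchingLawSteadySliceLiouvilleAnalytic
import Literature.Analysis.UnboundedOperators.HeatKernelBoundedData
import Literature.Analysis.UnboundedOperators.HeatKernelHeatEquation

/-!
# Route ClockStretchingLaw — `SteadySliceLiouville` (item stmt-NavierStokesRegularity-10572)

The support item of route `ClockStretchingLaw` of `NavierStokesRegularity`: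

  a smooth, divergence-free, KNSS-mild ancient solution `u` of Navier–Stokes on `ℝ³ × (-∞, 0)`
  with the Type I bound `‖u(t,x)‖ ≤ C/√(-t)` and ONE steady slice `∂ₜu(t₀, ·) ≡ 0` (`t₀ < 0`) is
  identically zero.

## Proof

Write the KNSS-mild clause as `u(t) = e^{(t-s)Δ}u(s) - B¹_s(u,u)(t)` (`B = oseenDuhamel`,
`oseenDuhamel_one_eq_unfolded`). On every `(-∞, T]`, `T < 0`, `u` is bounded (Type I).

1. **Time analyticity** (`analyticOnNhd_uncurry_of_oseenMild`, file
   `ClockStretchingLawSteadySliceLiouvilleAnalytic`): `uncurry u` is real-analytic on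
   `(-∞, 0) × ℝ³` (Lemarié-Rieusset 2016, Thm. 9.12 + uniqueness of bounded Oseen solutions).
2. **Uniform bound on `∂ₜ²u` near `t₀`** (`exists_bound_iteratedDeriv_two`, same file): Dong–Zhang
   2020, Thm. 2.
3. **Forward local steadiness** (`steady_near_of_timeDeriv_eq_zero`, here): `u` and its time
   translate `u(· + h)` solve the integral equation from time `t₀` with free terms `e^{(t-t₀)Δ}u(t₀)`,
   `e^{(t-t₀)Δ}u(t₀ + h)`, which differ by at most `‖u(t₀+h) - u(t₀)‖_∞ ≤ A₂h²` (step 2 and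
   `∂ₜu(t₀) = 0`); the stability of bounded solutions under a change of the free term
   (`exists_oseenMild_stability_window`, file `ClockStretchingLawSteadySliceLiouvilleStability`,
   KNSS 2009 §4 fixed point) gives `‖u(t+h) - u(t)‖ ≤ 2A₂h²` on a window `(t₀, t₀ + η]` independent
   of `h`, hence `∂ₜu = 0` there and `u(t) = u(t₀)` for `t ∈ [t₀, t₀ + η]`.
4. **Identity theorem** (`clockStretchingLaw_steadySliceLiouville_proof`): `t ↦ u(t,x)` is analytic
   on `(-∞, 0)` and constant on `(t₀, t₀ + η)`, hence constant
   (`AnalyticOnNhd.eqOn_of_preconnected_of_eventuallyEq`); the Type I bound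
   `‖u(t₀,x)‖ = ‖u(t,x)‖ ≤ C/√(-t) → 0` (`t → -∞`) forces `u ≡ 0`.

## References

* H. Dong, Q. S. Zhang, *Time analyticity for the heat equation and Navier–Stokes equations*,
  J. Funct. Anal. 279 (2020) 108563 = arXiv:1907.01687, §3 Thm. 2.
* P. G. Lemarié-Rieusset, *The Navier–Stokes Problem in the 21st Century*, CRC Press 2016,
  Thm. 9.12.
* G. Koch, N. Nadirashvili, G. Seregin, V. Šverák, Acta Math. 203 (2009) = arXiv:0709.3599, §4.
-/

noncomputable section

open Literature.Analysis.FluidPDE MeasureTheory Set Function Filter Topology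
open Literature.Analysis.UnboundedOperators (heatExtension heatKernel heatExtension_sub_of_bound
  norm_heatExtension_le)
open scoped ENNReal NNReal

namespace Summit.NavierStokesRegularity.NavierStokesRegularity.Theorems

/-! ### Step 3: forward local steadiness from one steady slice -/

section Steady

variable {C : ℝ} {u : ℝ → (EuclideanSpace ℝ (Fin 3)) → (EuclideanSpace ℝ (Fin 3))}

/-- **A steady slice propagates forward for a short time.** If `∂ₜu(t₀, ·) ≡ 0` then
`u(t, ·) = u(t₀, ·)` for `t ∈ [t₀, t₀ + η]`, some `η > 0` with `t₀ + η < 0`. Proof: for small `h > 0`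
the translate `u(· + h)` and `u` solve the Oseen integral equation from time `t₀` with free terms
`e^{(t-t₀)Δ}u(t₀ + h)` and `e^{(t-t₀)Δ}u(t₀)`, at distance `≤ ‖u(t₀+h) - u(t₀)‖_∞ ≤ A₂h²` (maximum
principle `norm_heatExtension_le`, the bound `A₂` on `∂ₜ²u` of `exists_bound_iteratedDeriv_two` and
`∂ₜu(t₀) = 0`, by two mean value inequalities); the stability window
`exists_oseenMild_stability_window` (independent of `h`) gives `‖u(t + h) - u(t)‖ ≤ 2A₂h²`, so the
time derivative vanishes on the window and `u(·, x)` is constant there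
(`constant_of_derivWithin_zero`). -/
theorem steady_near_of_timeDeriv_eq_zero
    (hsm : ContDiffOn ℝ (⊤ : ℕ∞) (uncurry u) (Iio 0 ×ˢ univ))
    (hdiv : ∀ t < 0, VectorCalculus.IsDivFree (u t))
    (hmildO : ∀ s t : ℝ, s < t → t < 0 → ∀ x,
      u t x = heatExtension (u s) (t - s) x - oseenDuhamel 1 s u u t x)
    (hTI : HasTypeITimeDecay C u) {t₀ : ℝ} (ht₀ : t₀ < 0)
    (hsteady : ∀ x, timeDeriv u t₀ x = 0) :
    ∃ η : ℝ, 0 < η ∧ t₀ + η < 0 ∧ ∀ t ∈ Icc t₀ (t₀ + η), ∀ x, u t x = u t₀ x := by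
  have hC : 0 ≤ C := steadySlice_typeI_const_nonneg hTI
  have hcont : ContinuousOn (uncurry u) (Iio 0 ×ˢ univ) := hsm.continuousOn
  obtain ⟨A₂, h₀, hh₀, hth₀, hA₂⟩ := exists_bound_iteratedDeriv_two hsm hdiv hmildO hTI ht₀
  -- a bound `M` on `(-∞, t₀/2]` and the stability window `η` for `(ν, M) = (1, M)`
  set M : ℝ := C / Real.sqrt (-(t₀ / 2)) with hM
  have hM0 : 0 ≤ M := div_nonneg hC (Real.sqrt_nonneg _)
  have hbdM : ∀ τ ≤ t₀ / 2, ∀ y, ‖u τ y‖ ≤ M := fun τ hτ y =>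
    steadySlice_norm_le_of_hasTypeITimeDecay hTI hC (by linarith) hτ y
  obtain ⟨η, hη, hstab⟩ :=
    exists_oseenMild_stability_window (EuclideanSpace ℝ (Fin 3)) (ν := (1 : ℝ)) (M := M) one_pos hM0
  -- comparison interval `(t₀, T)`, `T = 3t₀/4`; translates by `h ∈ (0, h₁]`
  set T : ℝ := 3 * t₀ / 4 with hT
  have ht₀T : t₀ < T := by rw [hT]; linarith
  have hT0 : T < 0 := by rw [hT]; linarith
  set h₁ : ℝ := min h₀ (-t₀ / 4) with hh₁
  have hh₁0 : 0 < h₁ := lt_min hh₀ (by linarith)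
  have hh₁h₀ : h₁ ≤ h₀ := min_le_left _ _
  have hh₁q : h₁ ≤ -t₀ / 4 := min_le_right _ _
  -- (a) `‖u(t₀ + h, y) - u(t₀, y)‖ ≤ A₂ h²` for `0 < h ≤ h₀`
  have hA₂0 : 0 ≤ A₂ := (norm_nonneg _).trans (hA₂ t₀ ⟨le_rfl, by linarith⟩ 0)
  have hquad : ∀ h : ℝ, 0 < h → h ≤ h₀ → ∀ y, ‖u (t₀ + h) y - u t₀ y‖ ≤ A₂ * h ^ 2 := by
    intro h hh hhh₀ y
    -- first: `‖∂ₜu(τ, y)‖ ≤ A₂ (τ - t₀)` on `[t₀, t₀ + h₀]`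
    have hder : ∀ τ ∈ Icc t₀ (t₀ + h₀), ‖deriv (fun s => u s y) τ‖ ≤ A₂ * (τ - t₀) := by
      intro τ hτ
      have h0 : deriv (fun s => u s y) t₀ = 0 := hsteady y
      have h1 := norm_image_sub_le_of_norm_deriv_le_segment' (f := deriv fun s => u s y)
        (f' := iteratedDeriv 2 fun s => u s y) (a := t₀) (b := t₀ + h₀) (C := A₂)
        (fun σ hσ => ((steadySlice_hasDerivAt_curve hsm y (by linarith [hσ.2])).2).hasDerivWithinAt)
        (fun σ hσ => hA₂ σ (Ico_subset_Icc_self hσ) y) τ hτ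
      rwa [h0, sub_zero] at h1
    have h2 := norm_image_sub_le_of_norm_deriv_le_segment' (f := fun s => u s y)
      (f' := deriv fun s => u s y) (a := t₀) (b := t₀ + h) (C := A₂ * h)
      (fun σ hσ => ((steadySlice_hasDerivAt_curve hsm y (by linarith [hσ.2])).1).hasDerivWithinAt)
      (fun σ hσ => (hder σ ⟨hσ.1, by linarith [hσ.2]⟩).trans (by nlinarith [hσ.2, hσ.1]))
      (t₀ + h) ⟨by linarith, le_rfl⟩
    calc ‖u (t₀ + h) y - u t₀ y‖ ≤ A₂ * h * (t₀ + h - t₀) := h2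
      _ = A₂ * h ^ 2 := by ring
  -- (b) stability: `‖u(t + h, x) - u(t, x)‖ ≤ 2 A₂ h²` for `t ∈ (t₀, T)`, `t ≤ t₀ + η`
  have hstab' : ∀ h : ℝ, 0 < h → h ≤ h₁ → ∀ t ∈ Ioo t₀ T, t ≤ t₀ + η → ∀ x,
      ‖u t x - u (t + h) x‖ ≤ 2 * (A₂ * h ^ 2) := by
    intro h hh hhh₁ t ht htη x
    have hTh : T + h ≤ t₀ / 2 := by rw [hT]; linarith
    refine hstab (s := t₀) (T := T) (U := fun t x => heatExtension (u t₀) (t - t₀) x)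
      (V := fun t x => heatExtension (u (t₀ + h)) (t - t₀) x) (u := u) (v := fun τ => u (τ + h))
      ?_ (steadySlice_aestronglyMeasurable_translate hsm h (by linarith)) ?_ ?_ ?_ ?_ (by positivity) ?_ t ht htη x
    · exact (hcont.mono (prod_mono (fun τ hτ => (hτ.2.trans hT0 : τ < 0)) Subset.rfl)).aestronglyMeasurable
        (measurableSet_Ioo.prod MeasurableSet.univ)
    · exact fun τ hτ y => hbdM τ (by linarith [hτ.2]) y
    · exact fun τ hτ y => hbdM (τ + h) (by linarith [hτ.2]) y
    · exact fun t ht x => hmildO t₀ t ht.1 (ht.2.trans hT0) x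
    · intro t ht x
      show u (t + h) x = heatExtension (u (t₀ + h)) (t - t₀) x -
        oseenDuhamel 1 t₀ (fun τ => u (τ + h)) (fun τ => u (τ + h)) t x
      rw [oseenDuhamel_translate 1 t₀ h u u t x,
        hmildO (t₀ + h) (t + h) (by linarith [ht.1]) (by linarith [ht.2]) x, add_sub_add_right_eq_sub]
    · intro t ht x
      have hts : 0 < t - t₀ := sub_pos.2 ht.1
      show ‖heatExtension (u t₀) (t - t₀) x - heatExtension (u (t₀ + h)) (t - t₀) x‖ ≤ A₂ * h ^ 2
      rw [← heatExtension_sub_of_bound (steadySlice_continuous_slice hsm ht₀) (steadySlice_continuous_slice hsm (by linarith))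
        (fun z => hbdM t₀ (by linarith) z) (fun z => hbdM (t₀ + h) (by linarith) z) hts x]
      refine norm_heatExtension_le (fun z => ?_) hts x
      rw [norm_sub_rev]
      exact hquad h hh (hhh₁.trans hh₁h₀) z
  -- (c) the time derivative vanishes on `(t₀, t₀ + η')`, `η' = min η ((T - t₀)/2)`
  set η' : ℝ := min η ((T - t₀) / 2) with hη'
  have hη'0 : 0 < η' := lt_min hη (by linarith)
  have hη'η : η' ≤ η := min_le_left _ _
  have hη'T : t₀ + η' < T := by
    have : η' ≤ (T - t₀) / 2 := min_le_right _ _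
    linarith
  have hderiv0 : ∀ x, ∀ t ∈ Ioo t₀ (t₀ + η'), deriv (fun s => u s x) t = 0 := by
    intro x t ht
    have htT : t ∈ Ioo t₀ T := ⟨ht.1, ht.2.trans hη'T⟩
    have htη : t ≤ t₀ + η := by linarith [ht.2]
    have hf := (steadySlice_hasDerivAt_curve hsm x (htT.2.trans hT0)).1
    -- the right difference quotients tend to the derivative and are `O(h)`
    have hslope : Tendsto (fun h : ℝ => h⁻¹ • (u (t + h) x - u t x)) (𝓝[>] 0)
        (𝓝 (deriv (fun s => u s x) t)) :=
      (hasDerivAt_iff_tendsto_slope_zero.1 hf).mono_left (nhdsWithin_mono _ fun h hh => ne_of_gt hh)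
    have hbound : ∀ᶠ h : ℝ in 𝓝[>] 0, ‖h⁻¹ • (u (t + h) x - u t x)‖ ≤ 2 * A₂ * h := by
      filter_upwards [Ioc_mem_nhdsGT hh₁0] with h hh
      rw [norm_smul, norm_inv, Real.norm_of_nonneg hh.1.le, norm_sub_rev]
      calc h⁻¹ * ‖u t x - u (t + h) x‖ ≤ h⁻¹ * (2 * (A₂ * h ^ 2)) :=
            mul_le_mul_of_nonneg_left (hstab' h hh.1 hh.2 t htT htη x) (inv_nonneg.2 hh.1.le)
        _ = 2 * A₂ * h := by field_simp
    have hlim0 : Tendsto (fun h : ℝ => 2 * A₂ * h) (𝓝[>] 0) (𝓝 0) := by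
      have : Tendsto (fun h : ℝ => 2 * A₂ * h) (𝓝 0) (𝓝 (2 * A₂ * 0)) :=
        (continuous_const.mul continuous_id).tendsto 0
      rw [mul_zero] at this
      exact this.mono_left nhdsWithin_le_nhds
    have hle : ‖deriv (fun s => u s x) t‖ ≤ 0 :=
      le_of_tendsto_of_tendsto (tendsto_norm.comp hslope) hlim0 hbound
    exact norm_le_zero_iff.1 hle
  -- (d) constancy on `[t₀, t₀ + η']`
  refine ⟨η', hη'0, hη'T.trans hT0, fun t ht x => ?_⟩
  have hdiff : DifferentiableOn ℝ (fun s => u s x) (Icc t₀ (t₀ + η')) := fun s hs =>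
    ((steadySlice_hasDerivAt_curve hsm x (by linarith [hs.2, hη'T, hT0])).1).differentiableAt.differentiableWithinAt
  refine constant_of_derivWithin_zero hdiff (fun s hs => ?_) t ht
  have hsd : DifferentiableAt ℝ (fun s => u s x) s :=
    ((steadySlice_hasDerivAt_curve hsm x (by linarith [hs.2, hη'T, hT0])).1).differentiableAt
  rw [hsd.derivWithin (uniqueDiffOn_Icc (by linarith) s (Ico_subset_Icc_self hs))]
  rcases eq_or_lt_of_le hs.1 with h | h
  · rw [← h]; exact hsteady x
  · exact hderiv0 x s ⟨h, hs.2⟩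

end Steady

/-! ### The item -/

/-- **`SteadySliceLiouville`** (item stmt-NavierStokesRegularity-10572 of route
`ClockStretchingLaw`): a smooth divergence-free KNSS-mild ancient solution of Navier–Stokes on
`ℝ³ × (-∞, 0)` with the Type I bound `‖u(t,x)‖ ≤ C/√(-t)` and one steady slice `∂ₜu(t₀, ·) ≡ 0`,
`t₀ < 0`, vanishes identically. Proof: the steady slice propagates forward for a short time
(`steady_near_of_timeDeriv_eq_zero`: stability of bounded solutions of the Oseen integral
equation + Dong–Zhang's bound on `∂ₜ²u`); `t ↦ u(t,x)` is real-analytic on `(-∞, 0)`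
(`analyticOnNhd_uncurry_of_oseenMild`: Lemarié-Rieusset's local analyticity of Oseen's scheme +
uniqueness), hence constant by the identity theorem; and a time-independent Type I field is zero
(`C/√(-t) → 0` as `t → -∞`). -/
theorem clockStretchingLaw_steadySliceLiouville_proof :
    Summit.NavierStokesRegularity.NavierStokesRegularity.Theses.ClockStretchingLaw.SteadySliceLiouville := by
  intro C u hu t₀ ht₀ hsteady t ht x
  obtain ⟨hsm, hdiv, hmild, hTI⟩ := hu
  -- the KNSS-mild clause in the Oseen architecture
  have hmildO : ∀ s t : ℝ, s < t → t < 0 → ∀ x,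
      u t x = heatExtension (u s) (t - s) x - oseenDuhamel 1 s u u t x := by
    intro s t hst ht x
    rw [oseenDuhamel_one_eq_unfolded, ← heatFlow_of_pos (u s) (sub_pos.2 hst)]
    exact hmild s t hst ht x
  obtain ⟨η, hη, hη0, hconst⟩ := steady_near_of_timeDeriv_eq_zero hsm hdiv hmildO hTI ht₀ hsteady
  have han := analyticOnNhd_uncurry_of_oseenMild hsm hmildO hTI
  -- the time curve at `x` is analytic on `(-∞, 0)` and constant near `t₀ + η/2`
  have hf : AnalyticOnNhd ℝ (fun s => u s x) (Iio 0) := fun s hs =>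
    (han (s, x) (mk_mem_prod hs (mem_univ _))).curry_left
  have hg : AnalyticOnNhd ℝ (fun _ : ℝ => u t₀ x) (Iio 0) := fun _ _ => analyticAt_const
  have heq : (fun s => u s x) =ᶠ[𝓝 (t₀ + η / 2)] fun _ => u t₀ x := by
    have hmem : Ioo t₀ (t₀ + η) ∈ 𝓝 (t₀ + η / 2) := Ioo_mem_nhds (by linarith) (by linarith)
    filter_upwards [hmem] with s hs using hconst s (Ioo_subset_Icc_self hs) x
  have hz₀ : t₀ + η / 2 ∈ Iio (0 : ℝ) := by
    show t₀ + η / 2 < 0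
    linarith
  have hall : EqOn (fun s => u s x) (fun _ => u t₀ x) (Iio 0) :=
    hf.eqOn_of_preconnected_of_eventuallyEq hg isPreconnected_Iio hz₀ heq
  have hU : ∀ s : ℝ, s < 0 → u s x = u t₀ x := fun s hs => hall hs
  -- a time-independent Type I field vanishes
  have hzero : u t₀ x = 0 := by
    have hC : 0 ≤ C := steadySlice_typeI_const_nonneg hTI
    by_contra hne
    have hpos : 0 < ‖u t₀ x‖ := norm_pos_iff.2 hne
    set a : ℝ := C / ‖u t₀ x‖ + 1 with ha_def
    have ha : 0 < a := by positivity
    have hs : -(a ^ 2) < 0 := by nlinarith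
    have h1 := hTI (-(a ^ 2)) hs x
    rw [hU _ hs, neg_neg, Real.sqrt_sq ha.le] at h1
    have h2 : C / a < ‖u t₀ x‖ := by
      rw [div_lt_iff₀ ha, ha_def, mul_add, mul_one, mul_div_cancel₀ _ hpos.ne']
      linarith
    linarith
  rw [hU t ht, hzero]

end Summit.NavierStokesRegularity.NavierStokesRegularity.Theorems

end
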